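import Literature.AnabelianGeometry.EtaleTheta.ThetaCohomologyAnchored
import Literature.AnabelianGeometry.EtaleTheta.Discharge.Sec1EvalAtNaturalityAnchored
import HarnessLib

/-!
# [EtTh] Thm. 1.10, proof p. 30: the translated points `σ^{−a}·τ` of `Ÿ` are ANCHORED points
# (K2 junction, items 5 (a)(b), in the currency of `ThetaSetting.AnchoredPoint`; proof-only)

Mochizuki, *The étale theta function …*, Publ. RIMS **45** (2009) [EtTh], §1: Prop. 1.4 (iii) p. 22
("the restricted classes `…|_y ∈ H¹(G_L, Δ_Θ) ≅ H¹(G_L, Ẑ(1)) ≅ (L^×)^∧`"), Def. 1.9 (i) p. 29, proof of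
Thm. 1.10 p. 30 ("`γ` maps `τ` to …") [cite: MochizukiEtTh2009, Def 1.9 (i) p.29].  PROOF-ONLY file
(abc-iut cell, prover abc-iut-L2-d1 gen 4); sequel of this seat's `Sec1EvalAtNaturality.lean` (p420910)
and `Sec1EvalAtNaturalityAnchored.lean` (p421407), now valued in abc-iut-L2-t1's
`ThetaSetting.AnchoredPoint` (`ThetaCohomologyAnchored.lean`, p421374).  No definition, no named fact.

CONTENT.
* §A `ContH1.exists_conjTransport_injective` — the conjugation transport
  `T_σ : H¹(σ⁻¹Hσ, A) → H¹(H, A)` of `Sec1EvalAtNaturality.lean` is INJECTIVE (a transported coboundary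
  `h ↦ φ(h)aφ(h)⁻¹a⁻¹` comes from the coboundary of `a' := φ(σ)⁻¹ a φ(σ)`), with the same kernel identity
  `T_σ ∘ res = res ∘ conj(σ)`.
* §B `MuTwoSetting.exists_translatePoints_injective_of_prop15ii` — the translated points `τ_a`
  (`Dpt(τ_a) = σ^{−a}D_yσ^{a}`, prescribed admissible coordinates, natural evaluation) whose evaluation
  maps are moreover INJECTIVE as soon as `evalAt_y` is.
* §C `MuTwoSetting.exists_anchoredPoint_translates_of_prop15ii` — for an ANCHORED point `y`
  (`AnchoredPoint`: `evalAt_y` injective and `log(Ü)|_y ↦ Ü(y)`), `σ₁ ∈ Π^tp_X` translating the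
  coordinate class by `u₁` (`htrans`, an explicit hypothesis — the `ℤ`-action on `log(Ü)`, NOT derivable
  from Prop. 1.5 (ii)/(iii) as typed), and admissible coordinates `Ü(y)·u₁^a`, the translated points are
  again ANCHORED points, with `Dpt(τ_a) = σ₁^{−a}D_yσ₁^{a}`, `Ü(τ_a) = Ü(y)·u₁^a` and natural evaluation
  `evalAt_y((σ₁^a·x)|_y) = evalAt_{τ_a}(x|_{τ_a})` for every class `x ∈ H¹(Π^tp_Ÿ, Δ_Θ)`.
The only [EtTh] input is the named fact `Prop15ii` (F-2503), through abc-iut-w5-d234's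
`conj_inflTheta_eq_self_of_mem_Fdd2`.  HONEST READING: the coordinates are still prescribed (t1's
`coord_unique` says they are the only ones compatible with the anchoring); nothing of [EtTh] is asserted;
no side is taken on [IUTchIII] Cor. 3.12.
-/

namespace Literature.AnabelianGeometry.EtaleTheta

/-! ## §A. The conjugation transport on `H¹` is injective -/

section Transport

variable {G G' : Type*} [Group G] [TopologicalSpace G] [IsTopologicalGroup G]
  [Group G'] [TopologicalSpace G'] [IsTopologicalGroup G']
  (φ : G →* G') (A : Subgroup G') [A.Normal] [IsMulCommutative A]

open scoped IsMulCommutative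

/-- Conjugation by a fixed element is continuous on a normal subgroup. [folklore] -/
private theorem continuous_conjNormal'' {G₁ : Type*} [Group G₁] [TopologicalSpace G₁]
    [IsTopologicalGroup G₁] {B : Subgroup G₁} [B.Normal] (g : G₁) :
    Continuous fun b : B => MulAut.conjNormal g b :=
  continuous_induced_rng.2 (by
    simp only [Function.comp_def, MulAut.conjNormal_apply]
    fun_prop)

omit [TopologicalSpace G] [IsTopologicalGroup G] in
/-- `σ⁻¹ h σ` lies in the conjugate subgroup `σ⁻¹Hσ = (conj σ)⁻¹(H)` for `h ∈ H`. [folklore] -/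
private theorem conj_inv_mul_mem_comap_conj' (σ : G) (H : Subgroup G) (h : H) :
    σ⁻¹ * (h : G) * σ ∈ H.comap (MulAut.conj σ).toMonoidHom := by
  rw [Subgroup.mem_comap]
  change σ * (σ⁻¹ * (h : G) * σ) * σ⁻¹ ∈ H
  simp [mul_assoc]

omit [TopologicalSpace G] [IsTopologicalGroup G] in
/-- For `N ⊴ G` and `H ≤ N`: the conjugate `σ⁻¹Hσ` lies in `N`. [folklore] -/
private theorem comap_conj_le_of_le' {N : Subgroup G} [N.Normal] (σ : G) {H : Subgroup G}
    (hH : H ≤ N) : H.comap (MulAut.conj σ).toMonoidHom ≤ N := by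
  intro k hk
  rw [Subgroup.mem_comap] at hk
  have hk' : σ * k * σ⁻¹ ∈ N := hH hk
  have := Subgroup.Normal.conj_mem inferInstance _ hk' σ⁻¹
  simpa [mul_assoc] using this

/-- **The conjugation transport on `H¹` is injective.**  For `σ ∈ G`, `N ⊴ G` and `H ≤ N` there is an
INJECTIVE homomorphism `T_σ : H¹(σ⁻¹Hσ, A) → H¹(H, A)`, `(T_σ f)(h) = φ(σ)·f(σ⁻¹hσ)·φ(σ)⁻¹` on
cocycles, with `T_σ (x|_{σ⁻¹Hσ}) = (σ·x)|_H` for every `x ∈ H¹(N, A)` (injectivity: if `T_σ f` is the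
coboundary of `a`, then `f` is the coboundary of `φ(σ)⁻¹aφ(σ)`).  Strengthens
`ContH1.exists_conjTransport`. [cite: NeukirchSchmidtWingberg2008, I §5] -/
theorem ContH1.exists_conjTransport_injective {N : Subgroup G} [N.Normal] (σ : G) {H : Subgroup G}
    (hH : H ≤ N) (hH' : H.comap (MulAut.conj σ).toMonoidHom ≤ N) :
    ∃ T : ContH1 φ A (H.comap (MulAut.conj σ).toMonoidHom) →* ContH1 φ A H,
      Function.Injective T ∧
      ∀ x : ContH1 φ A N,
        T (ContH1.res φ A hH' x) = ContH1.res φ A hH (ContH1.conj φ A σ x) := by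
  -- transport of elements `h ↦ σ⁻¹ h σ`
  let ι : H → H.comap (MulAut.conj σ).toMonoidHom := fun h =>
    ⟨σ⁻¹ * (h : G) * σ, conj_inv_mul_mem_comap_conj' σ H h⟩
  have hι_cont : Continuous ι :=
    Continuous.subtype_mk (by fun_prop) _
  have hι_mul : ∀ g h : H, ι (g * h) = ι g * ι h := fun g h => by
    apply Subtype.ext
    change σ⁻¹ * ((g : G) * h) * σ = σ⁻¹ * g * σ * (σ⁻¹ * h * σ)
    group
  have hφι : ∀ h : H, φ σ * φ ((ι h : H.comap (MulAut.conj σ).toMonoidHom) : G) = φ (h : G) * φ σ :=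
    fun h => by
    change φ σ * φ (σ⁻¹ * (h : G) * σ) = _
    rw [← map_mul, ← map_mul]
    congr 1
    group
  -- transport of cocycles
  let tc : contCocycles φ A (H.comap (MulAut.conj σ).toMonoidHom) →* contCocycles φ A H :=
    { toFun := fun f => ⟨fun h => MulAut.conjNormal (φ σ) (f.1 (ι h)),
        (continuous_conjNormal'' (φ σ)).comp (f.2.1.comp hι_cont),
        fun g h => by
          dsimp only
          rw [hι_mul, f.2.2, map_mul]
          congr 1
          rw [← MulAut.mul_apply, ← map_mul, hφι, map_mul, MulAut.mul_apply]⟩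
      map_one' := Subtype.ext (funext fun h => by simp)
      map_mul' := fun f g => Subtype.ext (funext fun h => by
        change MulAut.conjNormal (φ σ) (f.1 (ι h) * g.1 (ι h)) =
          MulAut.conjNormal (φ σ) (f.1 (ι h)) * MulAut.conjNormal (φ σ) (g.1 (ι h))
        rw [map_mul]) }
  -- it preserves coboundaries, hence descends to `H¹`
  let T : ContH1 φ A (H.comap (MulAut.conj σ).toMonoidHom) →* ContH1 φ A H :=
    QuotientGroup.map _ _ tc (by
      intro f hf
      obtain ⟨a, ha⟩ := (mem_contCoboundaries_iff _).mp (Subgroup.mem_subgroupOf.mp hf)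
      refine Subgroup.mem_subgroupOf.mpr ((mem_contCoboundaries_iff _).mpr
        ⟨MulAut.conjNormal (φ σ) a, ?_⟩)
      funext h
      have hx := congrFun ha (ι h)
      apply Subtype.ext
      change ((MulAut.conjNormal (φ σ) (f.1 (ι h)) : A) : G') = _
      rw [hx]
      simp only [MulAut.conjNormal_apply, Subgroup.coe_mul, Subgroup.coe_inv]
      change φ σ * (φ (σ⁻¹ * (h : G) * σ) * (a : G') * (φ (σ⁻¹ * (h : G) * σ))⁻¹ * (a : G')⁻¹) * (φ σ)⁻¹ = _
      simp only [map_mul, map_inv]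
      group)
  refine ⟨T, ?_, fun x => ?_⟩
  · -- injectivity: a transported coboundary is a coboundary
    refine (injective_iff_map_eq_one T).mpr fun x hx => ?_
    induction x using QuotientGroup.induction_on with
    | H f =>
      have hx' : (QuotientGroup.mk (tc f) : ContH1 φ A H) = 1 := hx
      rw [QuotientGroup.eq_one_iff] at hx'
      obtain ⟨a, ha⟩ := (mem_contCoboundaries_iff _).mp (Subgroup.mem_subgroupOf.mp hx')
      refine (QuotientGroup.eq_one_iff _).mpr (Subgroup.mem_subgroupOf.mpr
        ((mem_contCoboundaries_iff _).mpr ⟨MulAut.conjNormal (φ σ)⁻¹ a, ?_⟩))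
      funext k
      -- `k = σ⁻¹ (σ k σ⁻¹) σ` with `σ k σ⁻¹ ∈ H`
      have hk : ι ⟨σ * (k : G) * σ⁻¹, k.2⟩ = k := Subtype.ext (by
        change σ⁻¹ * (σ * (k : G) * σ⁻¹) * σ = k
        group)
      have hfk := congrFun ha ⟨σ * (k : G) * σ⁻¹, k.2⟩
      change MulAut.conjNormal (φ σ) (f.1 (ι ⟨σ * (k : G) * σ⁻¹, k.2⟩)) = _ at hfk
      rw [hk] at hfk
      have hfk' : f.1 k = MulAut.conjNormal (φ σ)⁻¹
          (MulAut.conjNormal (φ ((⟨σ * (k : G) * σ⁻¹, k.2⟩ : H) : G)) a * a⁻¹) := by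
        have := congrArg (MulAut.conjNormal (φ σ)⁻¹) hfk
        rwa [← MulAut.mul_apply, ← map_mul, inv_mul_cancel, map_one, MulAut.one_apply] at this
      change f.1 k = _
      rw [hfk']
      apply Subtype.ext
      simp only [MulAut.conjNormal_apply, Subgroup.coe_mul, Subgroup.coe_inv]
      simp only [map_mul, map_inv]
      group
  · induction x using QuotientGroup.induction_on with
    | H f =>
      -- both sides are classes of the same cocycle `h ↦ φ(σ) f(σ⁻¹ h σ) φ(σ)⁻¹`
      change (QuotientGroup.mk (tc (ContH1.resCocycle φ A hH' f)) : ContH1 φ A H) =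
        QuotientGroup.mk (ContH1.resCocycle φ A hH (ContH1.conjCocycle φ A σ f))
      congr 1
      apply Subtype.ext
      funext h
      have hpt : (⟨σ⁻¹ * (h : G) * σ, hH' (conj_inv_mul_mem_comap_conj' σ H h)⟩ : N) =
          MulAut.conjNormal σ⁻¹ ⟨(h : G), hH h.2⟩ := by
        apply Subtype.ext
        simp [mul_assoc]
      change MulAut.conjNormal (φ σ) (f.1 ⟨σ⁻¹ * (h : G) * σ, hH' (conj_inv_mul_mem_comap_conj' σ H h)⟩) =
        MulAut.conjNormal (φ σ) (f.1 (MulAut.conjNormal σ⁻¹ ⟨(h : G), hH h.2⟩))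
      rw [hpt]

end Transport

/-! ## §B. Translated points with injective evaluation -/

namespace MuTwoSetting

open Literature.AnabelianGeometry.SemiGraphs

variable {p : ℕ} [Fact p.Prime] (M : MuTwoSetting p)

/-- **Translated points with INJECTIVE evaluation.**  As `exists_translatePoints_of_prop15ii`
(`Dpt(τ_a) = σ^{−a}D_yσ^{a}`, prescribed admissible coordinates `w a`, natural evaluation
`evalAt_y((σ^a·x)|_y) = evalAt_{τ_a}(x|_{τ_a})`), and moreover: if `evalAt_y` is injective
("`H¹(G_L, Δ_Θ) ≅ … ≅ (L^×)^∧`", p. 22), so is every `evalAt_{τ_a}` (it is `evalAt_y ∘ T_{σ^a}` with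
`T_{σ^a}` the injective conjugation transport).  Input: `Prop15ii` (F-2503) only.
[cite: MochizukiEtTh2009, Def 1.9 (i) p.29] -/
theorem exists_translatePoints_injective_of_prop15ii (hC : M.toThetaSetting.Compat)
    {E : M.toThetaSetting.KummerData} (h15ii : ThetaSetting.Prop15ii E hC)
    (y : ThetaSetting.NonCuspidalPoint E) (σ : M.PiTemp) (w : ℤ → (↥M.Kdd)ˣ)
    (hw : ∀ a b : ℤ, ((w a : M.Kdd) : PadicAlgCl p) ≠ M.toThetaSetting.qdd ^ b ∧
      ((w a : M.Kdd) : PadicAlgCl p) ≠ -(M.toThetaSetting.qdd ^ b)) :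
    haveI := hC.GtpYdd_normal
    ∃ τ_ : ℤ → ThetaSetting.NonCuspidalPoint E,
      (∀ a : ℤ, (τ_ a).Dpt = y.Dpt.comap (MulAut.conj (σ ^ a)).toMonoidHom) ∧
      (∀ a : ℤ, (τ_ a).coord = w a) ∧
      (∀ (a : ℤ) (x : M.toThetaSetting.H1 M.toThetaSetting.GtpYdd),
        y.evalAt (ContH1.res M.toTheta M.toThetaSetting.DeltaTheta y.Dpt_le
            (ContH1.conj M.toTheta M.toThetaSetting.DeltaTheta (σ ^ a) x)) =
          (τ_ a).evalAt (ContH1.res M.toTheta M.toThetaSetting.DeltaTheta (τ_ a).Dpt_le x)) ∧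
      (Function.Injective y.evalAt → ∀ a : ℤ, Function.Injective (τ_ a).evalAt) := by
  haveI := hC.GtpYdd_normal
  -- per-`a` construction, then `choose`
  have key : ∀ a : ℤ, ∃ τa : ThetaSetting.NonCuspidalPoint E,
      τa.Dpt = y.Dpt.comap (MulAut.conj (σ ^ a)).toMonoidHom ∧ τa.coord = w a ∧
      (∀ x : M.toThetaSetting.H1 M.toThetaSetting.GtpYdd,
        y.evalAt (ContH1.res M.toTheta M.toThetaSetting.DeltaTheta y.Dpt_le
            (ContH1.conj M.toTheta M.toThetaSetting.DeltaTheta (σ ^ a) x)) =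
          τa.evalAt (ContH1.res M.toTheta M.toThetaSetting.DeltaTheta τa.Dpt_le x)) ∧
      (Function.Injective y.evalAt → Function.Injective τa.evalAt) := by
    intro a
    set s : M.PiTemp := σ ^ a with hs_def
    have hD' : y.Dpt.comap (MulAut.conj s).toMonoidHom ≤ M.GtpYdd :=
      comap_conj_le_of_le' s y.Dpt_le
    obtain ⟨T, hTinj, hT⟩ := ContH1.exists_conjTransport_injective M.toTheta
      M.toThetaSetting.DeltaTheta (N := M.GtpYdd) s y.Dpt_le hD'
    -- the constant classes are fixed by `s` (Prop 1.5 (ii): `F̈² = Im κ̈`)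
    have hfix : ∀ c : E.KddHat, ContH1.conj M.toTheta M.toThetaSetting.DeltaTheta s
        (M.toThetaSetting.inflTheta M.toThetaSetting.GtpYdd (E.kumYdd c)) =
        M.toThetaSetting.inflTheta M.toThetaSetting.GtpYdd (E.kumYdd c) := fun c =>
      ThetaSetting.conj_inflTheta_eq_self_of_mem_Fdd2 hC (M.aug_mem_map_aug_GtpYdd s)
        (by rw [h15ii.Fdd2_eq]; exact ⟨c, rfl⟩)
    refine ⟨{ Dpt := y.Dpt.comap (MulAut.conj s).toMonoidHom
              Dpt_le := hD'
              aug_injOn := ?_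
              map_aug_Dpt := ?_
              coord := w a
              coord_ne_cusp := hw a
              evalAt := y.evalAt.comp T
              evalAt_kum := ?_ }, rfl, rfl, fun x => ?_, fun hinj => ?_⟩
    · -- `aug` is injective on `s⁻¹ D_y s`
      intro k₁ hk₁ k₂ hk₂ heq
      have hk₁' : s * k₁ * s⁻¹ ∈ y.Dpt := hk₁
      have hk₂' : s * k₂ * s⁻¹ ∈ y.Dpt := hk₂
      have heq' : M.aug (s * k₁ * s⁻¹) = M.aug (s * k₂ * s⁻¹) := by
        rw [map_mul, map_mul, map_mul, map_mul]
        exact congrArg (fun g => M.aug s * g * M.aug s⁻¹) heq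
      have := y.aug_injOn hk₁' hk₂' heq'
      simpa using this
    · -- its `aug`-image is `G_K̈ = G_K`
      ext g
      constructor
      · rintro ⟨k, hk, rfl⟩
        have hk' : s * k * s⁻¹ ∈ y.Dpt := hk
        have hmem : M.aug.toMonoidHom (s * k * s⁻¹) ∈ M.GKdd := by
          rw [← y.map_aug_Dpt]; exact ⟨_, hk', rfl⟩
        rw [M.GKdd_eq_GK] at hmem ⊢
        have h1 : M.aug.toMonoidHom k =
            (M.aug.toMonoidHom s)⁻¹ * M.aug.toMonoidHom (s * k * s⁻¹) * M.aug.toMonoidHom s := by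
          simp only [map_mul, map_inv]; group
        rw [h1]
        exact mul_mem (mul_mem (inv_mem (M.aug_mem_GK s)) hmem) (M.aug_mem_GK s)
      · intro hg
        rw [M.GKdd_eq_GK] at hg
        have hg' : M.aug.toMonoidHom s * g * (M.aug.toMonoidHom s)⁻¹ ∈ M.GKdd := by
          rw [M.GKdd_eq_GK]
          exact mul_mem (mul_mem (M.aug_mem_GK s) hg) (inv_mem (M.aug_mem_GK s))
        rw [← y.map_aug_Dpt] at hg'
        obtain ⟨d, hd, hdg⟩ := hg'
        refine ⟨s⁻¹ * d * s, ?_, ?_⟩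
        · change s * (s⁻¹ * d * s) * s⁻¹ ∈ y.Dpt
          simpa [mul_assoc] using hd
        · simp only [map_mul, map_inv, hdg]; group
    · -- `evalAt_kum`: the constant classes are `s`-invariant
      intro c
      change y.evalAt (T (ContH1.res M.toTheta M.toThetaSetting.DeltaTheta hD'
        (M.toThetaSetting.inflTheta M.toThetaSetting.GtpYdd (E.kumYdd c)))) = c
      rw [hT, hfix c]
      exact y.evalAt_kum c
    · -- naturality
      change _ = y.evalAt (T (ContH1.res M.toTheta M.toThetaSetting.DeltaTheta hD' x))
      rw [hT]
    · -- injectivity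
      exact hinj.comp hTinj
  choose τ_ hτD hτw hτnat hτinj using key
  exact ⟨τ_, hτD, hτw, fun a x => hτnat a x, fun hinj a => hτinj a hinj⟩

/-! ## §C. Translates of anchored points are anchored -/

/-- **The translated points `σ₁^{−a}·y` of an ANCHORED point are ANCHORED points** (proof of Thm. 1.10,
p. 30: "`γ` maps `τ` to …", with Prop. 1.4 (iii) p. 22 at each of them).  For `y : AnchoredPoint`
(injective evaluation, `log(Ü)|_y ↦ Ü(y)`), `σ₁ ∈ Π^tp_X` translating the coordinate class,
`σ₁·log(Ü) = log(Ü) + κ̈(u₁)` (`htrans` — an explicit hypothesis: the `ℤ = Π^tp_X/Π^tp_Ÿ`-action on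
`log(Ü)`, which the typed Prop. 1.5 (ii)/(iii) do not supply), and admissible coordinates `Ü(y)·u₁^a ∉ ±q̈^ℤ`,
there are ANCHORED points `τ_a` with `Dpt(τ_a) = σ₁^{−a}·D_y·σ₁^{a}`, `Ü(τ_a) = Ü(y)·u₁^a`, and natural
evaluation `evalAt_y((σ₁^a·x)|_y) = evalAt_{τ_a}(x|_{τ_a})` for EVERY class `x ∈ H¹(Π^tp_Ÿ, Δ_Θ)` — items
5 (a)(b) of abc-iut-L2-t6's K2 checklist in the currency of `AnchoredPoint`.  Input: `Prop15ii` (F-2503).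
[cite: MochizukiEtTh2009, Def 1.9 (i) p.29] -/
theorem exists_anchoredPoint_translates_of_prop15ii (hC : M.toThetaSetting.Compat)
    {E : M.toThetaSetting.KummerData} (h15ii : ThetaSetting.Prop15ii E hC)
    (y : ThetaSetting.AnchoredPoint E) (σ₁ : M.PiTemp) (u₁ : (↥M.Kdd)ˣ)
    (htrans : haveI := hC.GtpYdd_normal
      ContH1.conj M.toTheta M.toThetaSetting.DeltaTheta σ₁
          (M.toThetaSetting.inflTheta M.toThetaSetting.GtpYdd E.logUdd) =
        M.toThetaSetting.inflTheta M.toThetaSetting.GtpYdd E.logUdd *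
          M.toThetaSetting.inflTheta M.toThetaSetting.GtpYdd (E.kumYdd (E.toKddHat u₁)))
    (hw : ∀ a b : ℤ, (((y.coord * u₁ ^ a : (↥M.Kdd)ˣ) : M.Kdd) : PadicAlgCl p) ≠ M.toThetaSetting.qdd ^ b ∧
      (((y.coord * u₁ ^ a : (↥M.Kdd)ˣ) : M.Kdd) : PadicAlgCl p) ≠ -(M.toThetaSetting.qdd ^ b)) :
    haveI := hC.GtpYdd_normal
    ∃ τ_ : ℤ → ThetaSetting.AnchoredPoint E,
      (∀ a : ℤ, (τ_ a).Dpt = y.Dpt.comap (MulAut.conj (σ₁ ^ a)).toMonoidHom) ∧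
      (∀ a : ℤ, (τ_ a).coord = y.coord * u₁ ^ a) ∧
      (∀ (a : ℤ) (x : M.toThetaSetting.H1 M.toThetaSetting.GtpYdd),
        y.evalAt (ContH1.res M.toTheta M.toThetaSetting.DeltaTheta y.Dpt_le
            (ContH1.conj M.toTheta M.toThetaSetting.DeltaTheta (σ₁ ^ a) x)) =
          (τ_ a).evalAt (ContH1.res M.toTheta M.toThetaSetting.DeltaTheta (τ_ a).Dpt_le x)) := by
  haveI := hC.GtpYdd_normal
  obtain ⟨τ_, hD, hcoord, hnat, hinj⟩ := M.exists_translatePoints_injective_of_prop15ii hC h15ii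
    y.toNonCuspidalPoint σ₁ (fun a => y.coord * u₁ ^ a) hw
  -- anchoring of the translated coordinate class: naturality, the translation law, the anchoring of
  -- `y` and `evalAt_kum`
  have hanch : ∀ a : ℤ, (τ_ a).evalAt (ContH1.res M.toTheta M.toThetaSetting.DeltaTheta (τ_ a).Dpt_le
      (M.toThetaSetting.inflTheta M.toThetaSetting.GtpYdd E.logUdd)) = E.toKddHat (τ_ a).coord := by
    intro a
    rw [← hnat a, M.conj_zpow_inflTheta_logUdd_eq hC h15ii σ₁ u₁ htrans a, map_mul, map_mul,
      y.evalAt_logUdd, y.evalAt_kum, hcoord a, map_mul]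
  refine ⟨fun a => { toNonCuspidalPoint := τ_ a
                     evalAt_injective := hinj y.evalAt_injective a
                     evalAt_logUdd := hanch a }, hD, hcoord, fun a x => hnat a x⟩

end MuTwoSetting

end Literature.AnabelianGeometry.EtaleTheta
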